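import Literature.AlgebraicGeometry.HodgeTheory.BlochSemiregularityTheorem
import Literature.AlgebraicGeometry.Motives.VarietiesGeometricallyIntegralProofs
import HarnessLib

/-!
# Bloch's semiregularity theorem (relative form): the degenerate corners, and the gap inventory

Family `hodge`, layer `Literature/AlgebraicGeometry/HodgeTheory`. Companion of
`BlochSemiregularityTheorem.lean`, whose NAMED FACT `Bloch1972_semiregularSubschemeLifts` (Bloch
1972, Thm. (7.1) with the proof of Thm. (7.4): a Bloch-semiregular local complete intersection
`Z₀ ⊆ X₀ = 𝒳_{s₀}` of pure codimension `p` whose component classes stay of type `(p,p)` along the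
Hartshorne-projective smooth family `f : 𝒳 ⟶ S` lifts to a closed subscheme of `𝒳 ×_S V`, flat
over an ÉTALE neighbourhood `(V, v₀) → (S, s₀)`, with central fibre `Z₀`) is NOT discharged here.
This file PROVES the fact in its degenerate corners and reduces it, sorry-free, to the interior
range `1 ≤ p ≤ n`, `Z₀ ≠ ∅`; its second purpose is to record precisely (module docstring, §Gap
inventory) which intermediate statements of the printed proof are missing from the tree.

## What is proved

* `exists_etale_flat_lift_of_isEmpty` — the conclusion of the fact for `Z₀ = ∅` (any `f`, `s₀`,
  `p`): `V := S`, `π := 𝟙`, `𝒵 := ∅` (Mathlib: a morphism out of the empty scheme is a closed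
  immersion, an open immersion, hence flat and étale; the pull-back of `∅` is empty, hence initial).
* `exists_etale_flat_lift_of_isIso` — the conclusion for `Z₀ = X₀` (`i₀` an isomorphism) and `f`
  flat: `V := S`, `𝒵 := 𝒳 ×_S S` itself, the central fibre being identified through
  `Motives.fiberOverFamilyPullbackIso` (`(𝒳 ×_S S)_{s₀} ≅ 𝒳_{s₀}` over `𝒳`).
* `isEmpty_of_forall_exists_coheight_eq_of_lt` — the purity clause of the fact ("every point of
  `Z₀` specialises from a point of `X₀` of codimension `p`") is unsatisfiable by a non-empty `Z₀`
  when `p > n = dim X₀` (`codim ≤ n` on a smooth projective `n`-fold,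
  `exists_height_eq_coheight_eq`), so there `Z₀ = ∅`.
* `isIso_of_forall_exists_coheight_eq_zero` — for `p = 0` and `Z₀ ≠ ∅` the purity clause puts the
  generic point of the integral scheme `X₀` in the closed set `i₀(Z₀)`, so the closed immersion
  `i₀` is surjective onto a reduced scheme, hence an isomorphism (Mathlib
  `isIso_of_isClosedImmersion_of_surjective`): `Z₀ = X₀` as schemes.
* `Bloch1972_semiregularSubschemeLifts_of_lt`, `Bloch1972_semiregularSubschemeLifts_zero` — the
  fact in the corners `n < p` and `p = 0`, in the fact's own binder shape.
* `Bloch1972_semiregularSubschemeLifts.of_interior` — **reduction**: the fact follows from its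
  restriction to `0 < p`, `p ≤ n`, `Z₀` non-empty. (The corner `p = n`, `Z₀` a zero-dimensional
  local complete intersection, where `IsBlochSemiregular` is vacuous, is NOT degenerate: it is the
  smoothness of the Hilbert scheme of points at lci points plus étale-local sections of smooth
  morphisms, and stays inside the interior range.)

Truth audit of the corners (asked by the consumer, crux `stmt-HodgeConjecture-1076`, line
`polar-patch-broken-cycles`): no corner of the statement as typed is false — `Z₀ = ∅` is allowed
for every `p` and the conclusion is then satisfiable (above); `p > n` forces `Z₀ = ∅`; `p = 0`
forces `Z₀ = X₀`, which lifts as the whole family; the purity clause `∀ z, ∃ z', coheight (i₀ z')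
= p ∧ i₀ z' ⤳ i₀ z` applied to the generic points of the components of `Z₀` forces EVERY
component to have codimension exactly `p` (not merely `≥ p` or `≤ p`); `ℕ`-subtraction inside
`IsBlochSemiregular` only makes the hypothesis vacuous (`p = 0`, `p > n`, `p = n`), never the
conclusion; non-reduced lci structures on `Z₀` are within Bloch's printed generality ("`Z₀ ⊂ X₀`
a local complete intersection of codimension `p`"; `𝓘/𝓘²` locally free ⟹ lci in the regular
`X₀`, Matsumura Thm. 19.9).

## Gap inventory (why `Bloch1972_semiregularSubschemeLifts_holds` cannot be written today)

The printed proof is (7.1) = [Cor. (6.10) iterated along `Spec ℂ⟦t⟧/𝔪^{k+1}`] + [the Hilbert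
scheme of `X/S`, to turn the compatible lifts into an `Ŝ`-point] and then (proof of (7.4)) Artin
approximation. On the tree's carriers its conjunction splits into the five statements below
(Lean signatures in the tree's vocabulary; hypotheses `H(f,n,p,s₀,Z₀,i₀)` abbreviate the eight
hypotheses of the fact; `S_k` is the `k`-th infinitesimal neighbourhood of `s₀` in `S`, i.e.
`T.obj k` for `T : FormalGeometry.FormalNeighbourhoodTower (s₀.left).ker`, viewed over `ℂ` as
`Over.mk (T.ι k ≫ S.hom)` with `σ k := Over.homMk (T.ι k) rfl : _ ⟶ S`; `𝒳_k := familyPullback f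
(σ k)`; `Ŝ := Spec (AdicCompletion (maximalIdeal (S.left.presheaf.stalk s₀.pt))
(S.left.presheaf.stalk s₀.pt))` with `ŝ : Ŝ ⟶ S.left`,
`ŝ := Spec.map (algebraMap _ _) ≫ S.left.fromSpecStalk s₀.pt`, as in
`Resolution.Artin1969EtaleApproximation`). (G1)–(G3) give (F); (F), (A), (E) and a formal glue
give the fact.

* (G1) EMBEDDED DEFORMATIONS OF AN LCI SUBSCHEME ACROSS A SQUARE-ZERO EXTENSION OF THE BASE
  (Hartshorne, Deformation Theory, Thm. 6.2; Kollár, Rational Curves, §I.2 (local structure of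
  `Hilb` at an lci point); FGA explained, Ch. 6 (Fantechi–Göttsche), §6.4): for `Z_k ⊆ 𝒳_k`
  closed, flat over `S_k`, with `Z_k ×_{S_k} S_0 = Z₀` lci in `X₀`, an obstruction
  `ob(Z_k) ∈ normalSheafCohomology i₀ 1 ⊗_ℂ Γ(𝔪^{k+1}/𝔪^{k+2})` (`= H¹(Z₀, 𝒩) ⊗ I`) with
  `ob(Z_k) = 0 ↔ ∃ Z_{k+1} ⊆ 𝒳_{k+1}` closed, flat over `S_{k+1}`, `Z_{k+1} ×_{S_{k+1}} S_k = Z_k`;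
  lifts form a torsor under `H⁰(Z₀, 𝒩) ⊗ I`. Signature shape (a hypothesis structure over REAL
  carriers, like `Deformation.SquareZeroExtensionObstruction` but for embedded flat closed
  subschemes):
  `structure EmbeddedLciObstruction (f : 𝒳 ⟶ S) (s₀) (Z₀) (i₀) where ob : ∀ k (Z : (𝒳_k).left.
  IdealSheafData), Flat (Z.subschemeι ≫ (familyPullback.snd f (σ k)).left) → … →
  TensorProduct ℂ (normalSheafCohomology i₀ 1) ↥(𝔪^(k+1)/𝔪^(k+2)); ob_eq_zero_iff : …`.
  In tree: `normalSheaf`, `normalSheafCohomology` (real), first-order thickenings and the Illusie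
  obstruction for finite locally free MODULES (`Deformation/IllusieObstructionClass`, proved) —
  nothing for subschemes; `normalSheafCohomology` is a bare `Sheaf.H` group (no `ℂ`-module
  structure recorded).
* (G2) BLOCH'S COR. (6.10) ("`π(ob)` IS THE HODGE OBSTRUCTION"; Bloch §4–§6; Buchweitz–Flenner
  Thm. 7.8 (1) / Prop. 8.2; Pridham; Bloch–Esnault–Kerz, characteristic `0`, §1): if `Z₀` is
  semiregular (`IsBlochSemiregular i₀ n p`) and `d : 𝔪^{k+1}/𝔪^{k+2} → Ω¹_S ⊗ 𝒪_{S_k}` is injective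
  (true for the `𝔪`-adic filtration of a smooth `S`, Euler's identity in characteristic `0`), then
  `ob(Z_k) = 0 ↔` the de Rham class `[Z_k]_dR ∈ Fᵖ H^{2p}_dR(𝒳_k/S_k)` lifts to a `∇`-HORIZONTAL
  class in `Fᵖ H^{2p}_dR(𝒳_{k+1}/S_{k+1})`. NOT STATABLE today — missing carriers (definition
  requests):
  (i) relative algebraic de Rham cohomology `H^{m}_dR(𝒳_A/A)` of a smooth projective `𝒳_A → Spec A`
  (`A` Artinian / any base) as a locally free `A`-module with its HODGE FILTRATION `Fᵖ` (degenerate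
  Hodge-to-de Rham spectral sequence, base change) and its GAUSS–MANIN connection relative to `ℂ`
  (the tree's `hodgeCohomology X j k = Hᵏ(X, Ωʲ)` is one graded piece on one scheme; `complexBetti`
  is Betti cohomology of complex points; `IsOfHodgeType` lives on a single smooth projective
  variety); (ii) the de Rham CYCLE CLASS `[Z]_dR ∈ Fᵖ H^{2p}_dR` of a flat lci closed subscheme of
  codimension `p` (Bloch §4, via local cohomology `H^p_Z(Ω^p)` and the fundamental local class).
* (G3) THE HODGE INPUT (Bloch, proof of (7.4), first lines; Deligne's theorem of the fixed part is
  NOT needed in the global-class rendering): from `SupportClassStaysHodge f n p s₀ (closure {i₀ z})`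
  for the generic points `z` of the components and purity `classesSupportedOn X₀ K (2p) = ℂ·cl(K)`
  (Fulton 19.1.1; tree: `SupportedClassesPurity`, partial) build `B ∈ H^{2p}(𝒳(ℂ); ℂ)` with
  `B|_{X₀} = [Z₀] = Σ m_K cl(K)` and `B|_{𝒳_s}` of type `(p,p)` for all `s`; then (Betti–de Rham
  comparison in the family + "restrictions of a global class form a `∇`-flat section", the Betti
  half of which is the tree's `isCohomologicallyLocallyTrivialOn_univ_of_isSmoothProjectiveFamily`)
  the image of `B` in `H^{2p}_dR(𝒳_k/S_k)` is a horizontal class in `Fᵖ` restricting to `[Z₀]_dR`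
  for every `k`. Needs the carriers of (G2) plus the comparison `complexBetti 𝒳_s ≅ H_dR(𝒳_s/ℂ)`
  compatible with `Fᵖ` and with cycle classes of (possibly singular, non-reduced) lci subschemes
  (multiplicities `m_K` = lengths at the generic points).
* (F) = (G1)+(G2)+(G3) iterated (Bloch (7.1), formal part) — STATABLE today as a named fact:
  `∀ f n p, H(f,n,p,s₀,Z₀,i₀) → ∀ (T : FormalNeighbourhoodTower (s₀.left).ker), ∃ (Z : ∀ k,
  (familyPullback f (σ k)).left.IdealSheafData), (∀ k, Flat ((Z k).subschemeι ≫ (familyPullback.snd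
  f (σ k)).left)) ∧ (∀ k, (Z (k+1)).comap (base change of T.transition k) = Z k) ∧ (Z 0 =
  kernel ideal of Z₀ ↪ X₀ ≅ 𝒳_0)`.
* (A) GROTHENDIECK EXISTENCE FOR FLAT CLOSED SUBSCHEMES (EGA III₁ Thm. 5.1.4 with Cor. 5.1.8, and
  flatness over `Ŝ` by the local criterion of flatness, Matsumura Thm. 22.3 (1)⇔(5)): a compatible
  system `(Z k)` as in (F) is induced by a unique closed `Ẑ ⊆ 𝒳 ×_S Ŝ` (`familyPullback f ŝ`),
  flat over `Ŝ`. Tree: Grothendieck existence only for VECTOR BUNDLES over `W(k)` (`FormalGeometry/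
  GrothendieckExistenceVectorBundles*`, named fact + affine case proved); the tower
  `FormalNeighbourhoodTower` and its transition maps exist. Statable today.
* (E) ARTIN APPROXIMATION FOR FLAT FAMILIES OF CLOSED SUBSCHEMES (Artin 1969 Cor. (2.2) with
  `c = 1` for `F = Hilb_{𝒳/S}`): `Ẑ ⊆ 𝒳 ×_S Ŝ` closed and flat over `Ŝ` ⟹ `∃ (V, π : V ⟶ S étale,
  v₀ ↦ s₀) (𝒵 ⊆ 𝒳 ×_S V closed, flat over V)` with `𝒵_{v₀} = Ẑ ×_Ŝ Spec ℂ (= Z₀)` as closed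
  subschemes of `X₀` — exactly the conclusion of the fact. The tree HAS Cor. (2.1) (systems of
  polynomial equations) as the named fact `Resolution.Artin1969EtaleApproximation` (with proved
  reductions to Néron–Popescu desingularisation); (2.1) ⟹ (2.2) needs EITHER "`Hilb_{𝒳/S}` is
  locally of finite presentation" (EGA IV₃ 8.10.5 (closed subschemes descend along limits),
  11.2.6 (flatness), 8.5/8.9 — no decl in tree) OR representability (Nitsure Thm. 5.3: `Hilb_{𝒳/S}`
  is a scheme locally of finite type over `S` for `𝒳 ⊆ ℙᴺ × S` closed — no decl in tree; the tree
  has only the Hilbert functor OF POINTS `HilbertScheme.hilbertFunctorOfPoints` with the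
  representability PREDICATE `IsHilbertSchemeOfPoints` and the cases `n = 0, 1`), after which (A)
  is replaced by the remark that compatible `S_k`-points of an `S`-scheme form an `Ŝ`-point.
  Statable today (on `IdealSheafData` carriers, as `HilbertScheme/HilbertSchemeOfPoints` does).
* GLUE ((F)+(A)+(E) ⟹ the fact): bookkeeping of fibre products (`fiberOverFamilyPullbackIso`,
  `pullbackLeftPullbackSndIso`) as in `exists_etale_flat_lift_of_isIso` below; provable once (F),
  (A), (E) are in the tree. Localisation of `S` at an affine neighbourhood of `s₀` (Artin needs
  finite type; `Smooth S.hom` gives only locally of finite type) is harmless: the conclusion is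
  étale-local.

Load-bearing and specific to this fact: (G2) (with its carriers (i)–(ii)); generic
infrastructure: (G1), (A), (E).

## References

* [Bloch1972Semiregularity] S. Bloch, Invent. Math. 17 (1972): §4–§6, Cor. (6.10), Thm. (7.1),
  Thm. (7.3), Thm. (7.4) and its proof.
* [Artin1969] M. Artin, Publ. Math. IHÉS 36 (1969): Thm. (1.10), Cor. (2.1), Cor. (2.2).
* [Nitsure2005] N. Nitsure, Construction of Hilbert and Quot schemes (FGA explained), Thm. 5.3.
* [EGAIII1] EGA III₁, Thm. 5.1.4, Cor. 5.1.8; [EGAIV3] EGA IV₃, 8.5, 8.9, 8.10.5, 11.2.6.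
* [Hartshorne2010] R. Hartshorne, Deformation Theory, Thm. 6.2; [Kollar1996] §I.2.
* [Matsumura1987] Thm. 19.9, Thm. 22.3; [BuchweitzFlenner2003] Thm. 7.8 (1), Prop. 8.2.
-/

noncomputable section

open CategoryTheory CategoryTheory.Limits AlgebraicGeometry MonoidalCategory
open _root_.Topology

namespace Literature.AlgebraicGeometry.HodgeTheory

section HodgeTheory

open Literature.AlgebraicGeometry.Motives Literature.AlgebraicGeometry.Deformation

variable {𝒳 S : SchemeOver ℂ}

/-! ### Two small pieces of bookkeeping -/

/-- Transport of the fibre inclusion along an equality of points: for `s = s'` the canonical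
identification `𝒳_s = 𝒳_{s'}` (an `eqToHom`) followed by `𝒳_{s'} ⟶ 𝒳` is `𝒳_s ⟶ 𝒳`. [folklore] -/
theorem eqToHom_comp_fiberι (f : 𝒳 ⟶ S) {s s' : ComplexPoints S} (h : s = s') :
    eqToHom (congrArg (fiberOver f) h) ≫ fiberι f s' = fiberι f s := by
  subst h
  simp

/-- **Codimension is at most the dimension**: on the fibre `X₀ = 𝒳_{s₀}` of a smooth projective
family of relative dimension `n` every point has `coheight ≤ n` (`dim + codim = n`,
`exists_height_eq_coheight_eq`), so a subscheme `Z₀ ⊆ X₀` all of whose points specialise from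
points of codimension `p > n` is EMPTY — the purity clause of
`Bloch1972_semiregularSubschemeLifts` is unsatisfiable by a non-empty `Z₀` above the dimension.
[folklore] -/
theorem isEmpty_of_forall_exists_coheight_eq_of_lt {n p : ℕ} {f : 𝒳 ⟶ S}
    (hf : IsSmoothProjectiveFamily f n) (hlt : n < p) {s₀ : ComplexPoints S} {Z₀ : Scheme.{0}}
    (i₀ : Z₀ ⟶ (fiberOver f s₀).left)
    (hpure : ∀ z : Z₀, ∃ z' : Z₀, Order.coheight (i₀.base z') = (p : ℕ∞) ∧ i₀.base z' ⤳ i₀.base z) :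
    IsEmpty Z₀ := by
  refine ⟨fun z => ?_⟩
  obtain ⟨z', hz', -⟩ := hpure z
  obtain ⟨a, c, -, hc, hac⟩ := exists_height_eq_coheight_eq (hf.isSmoothProjective s₀) (i₀.base z')
  rw [hz'] at hc
  have : p = c := by exact_mod_cast hc
  omega

/-- **Codimension zero means the whole fibre**: if `Z₀ ≠ ∅` is a closed subscheme of the fibre
`X₀ = 𝒳_{s₀}` of a smooth projective family every point of which specialises from a point of
codimension `0` of `X₀`, then `i₀ : Z₀ ⟶ X₀` is an isomorphism. Indeed `X₀` is integral
(`IsSmoothProjective.isIntegral_holds`); a point of coheight `0` is maximal for the specialisation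
order, hence specialises to the generic point, which therefore lies in the closed set `i₀(Z₀)`; so
`i₀` is a surjective closed immersion onto a reduced scheme, an isomorphism (Mathlib
`isIso_of_isClosedImmersion_of_surjective`). [folklore] -/
theorem isIso_of_forall_exists_coheight_eq_zero {n : ℕ} {f : 𝒳 ⟶ S}
    (hf : IsSmoothProjectiveFamily f n) {s₀ : ComplexPoints S} {Z₀ : Scheme.{0}} [Nonempty Z₀]
    (i₀ : Z₀ ⟶ (fiberOver f s₀).left) [IsClosedImmersion i₀]
    (hpure : ∀ z : Z₀, ∃ z' : Z₀, Order.coheight (i₀.base z') = ((0 : ℕ) : ℕ∞) ∧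
      i₀.base z' ⤳ i₀.base z) :
    IsIso i₀ := by
  haveI : IsIntegral (fiberOver f s₀).left :=
    IsSmoothProjective.isIntegral_holds (hf.isSmoothProjective s₀)
  obtain ⟨z⟩ := ‹Nonempty Z₀›
  obtain ⟨z', hz', -⟩ := hpure z
  have hmax : IsMax (i₀.base z') := Order.coheight_eq_zero.1 (by simpa using hz')
  have hclosed : IsClosed (Set.range i₀.base) := i₀.isClosedEmbedding.isClosed_range
  have hη : genericPoint (fiberOver f s₀).left ∈ Set.range i₀.base := by
    have h1 : i₀.base z' ⤳ genericPoint (fiberOver f s₀).left :=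
      Scheme.le_iff_specializes.1 (hmax (Scheme.le_iff_specializes.2 (genericPoint_specializes _)))
    exact hclosed.closure_subset_iff.2 (Set.singleton_subset_iff.2 ⟨z', rfl⟩) h1.mem_closure
  have hrange : Set.range i₀.base = Set.univ := by
    apply Set.eq_univ_of_univ_subset
    rw [← genericPoint_closure ((fiberOver f s₀).left : Type _)]
    exact hclosed.closure_subset_iff.2 (Set.singleton_subset_iff.2 hη)
  haveI : Surjective i₀ := ⟨Set.range_eq_univ.1 hrange⟩
  exact isIso_of_isClosedImmersion_of_surjective i₀

/-! ### The conclusion of the fact in the two degenerate shapes of `Z₀` -/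

/-- **The empty subscheme lifts** (conclusion of `Bloch1972_semiregularSubschemeLifts` for
`Z₀ = ∅`, for any `f`, `s₀` and `i₀`): take `V := S`, `π := 𝟙_S` (étale), `v₀ := s₀`, `𝒵 := ∅`
with its unique morphism to `𝒳 ×_S S` (a closed immersion, and flat over `S`, the source being
empty); the pull-back of `∅` to the fibre over `s₀` is empty, hence initial, so it is isomorphic
to `Z₀ = ∅` and the compatibility square commutes trivially. [folklore] -/
theorem exists_etale_flat_lift_of_isEmpty (f : 𝒳 ⟶ S) (s₀ : ComplexPoints S) (Z₀ : Scheme.{0})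
    [IsEmpty Z₀] (i₀ : Z₀ ⟶ (fiberOver f s₀).left) :
    ∃ (V : SchemeOver ℂ) (π : V ⟶ S) (_ : Etale π.left) (v₀ : ComplexPoints V)
      (_ : AlgPoints.map π v₀ = s₀) (𝒵 : Scheme) (ι : 𝒵 ⟶ (familyPullback f π).left)
      (_ : IsClosedImmersion ι) (_ : Flat (ι ≫ (familyPullback.snd f π).left))
      (e : pullback ι (fiberι (familyPullback.snd f π) v₀).left ≅ Z₀),
      pullback.fst ι (fiberι (familyPullback.snd f π) v₀).left ≫ ι ≫
          (familyPullback.fst f π).left =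
        e.hom ≫ i₀ ≫ (fiberι f s₀).left := by
  haveI : IsEmpty ↥(pullback (Scheme.emptyTo (familyPullback f (𝟙 S)).left)
      (fiberι (familyPullback.snd f (𝟙 S)) s₀).left) :=
    (pullback.fst (Scheme.emptyTo (familyPullback f (𝟙 S)).left)
      (fiberι (familyPullback.snd f (𝟙 S)) s₀).left).base.hom.1.isEmpty
  refine ⟨S, 𝟙 S, ?_, s₀, AlgPoints.map_id_apply s₀, ∅, Scheme.emptyTo _, inferInstance,
    inferInstance, ⟨isInitialOfIsEmpty.to _, isInitialOfIsEmpty.to _,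
      isInitialOfIsEmpty.hom_ext _ _, isInitialOfIsEmpty.hom_ext _ _⟩,
    isInitialOfIsEmpty.hom_ext _ _⟩
  show Etale (𝟙 S.left); infer_instance

/-- **The whole fibre lifts** (conclusion of `Bloch1972_semiregularSubschemeLifts` when `i₀` is
an isomorphism, i.e. `Z₀ = X₀`, for `f` flat): take `V := S`, `π := 𝟙_S`, `v₀ := s₀` and
`𝒵 := 𝒳 ×_S S` with `ι := 𝟙` (a closed immersion; `𝒵 → S` is a base change of the flat `f`); the
fibre of `𝒵` over `s₀` is `(𝒳 ×_S S)_{s₀} ≅ 𝒳_{s₀} = X₀ ≅ Z₀` (`Motives.fiberOverFamilyPullbackIso`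
and `i₀⁻¹`), compatibly with the maps to `𝒳` (`fiberOverFamilyPullbackIso_hom_fiberι`).
[folklore] -/
theorem exists_etale_flat_lift_of_isIso (f : 𝒳 ⟶ S) [Flat f.left] (s₀ : ComplexPoints S)
    (Z₀ : Scheme.{0}) (i₀ : Z₀ ⟶ (fiberOver f s₀).left) [IsIso i₀] :
    ∃ (V : SchemeOver ℂ) (π : V ⟶ S) (_ : Etale π.left) (v₀ : ComplexPoints V)
      (_ : AlgPoints.map π v₀ = s₀) (𝒵 : Scheme) (ι : 𝒵 ⟶ (familyPullback f π).left)
      (_ : IsClosedImmersion ι) (_ : Flat (ι ≫ (familyPullback.snd f π).left))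
      (e : pullback ι (fiberι (familyPullback.snd f π) v₀).left ≅ Z₀),
      pullback.fst ι (fiberι (familyPullback.snd f π) v₀).left ≫ ι ≫
          (familyPullback.fst f π).left =
        e.hom ≫ i₀ ≫ (fiberι f s₀).left := by
  -- the identification `(𝒳 ×_S S)_{s₀} ≅ 𝒳_{s₀}` over `𝒳`, in `Over (Spec ℂ)`
  have key : (fiberOverFamilyPullbackIso f (𝟙 S) s₀ ≪≫
      eqToIso (congrArg (fiberOver f) (AlgPoints.map_id_apply s₀))).hom ≫ fiberι f s₀ =
      fiberι (familyPullback.snd f (𝟙 S)) s₀ ≫ familyPullback.fst f (𝟙 S) := by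
    rw [Iso.trans_hom, eqToIso.hom, Category.assoc,
      eqToHom_comp_fiberι f (AlgPoints.map_id_apply s₀), fiberOverFamilyPullbackIso_hom_fiberι]
  refine ⟨S, 𝟙 S, ?_, s₀, AlgPoints.map_id_apply s₀, (familyPullback f (𝟙 S)).left, 𝟙 _,
    inferInstance, ?_,
    asIso (pullback.snd (𝟙 _) (fiberι (familyPullback.snd f (𝟙 S)) s₀).left) ≪≫
      Iso.mk (fiberOverFamilyPullbackIso f (𝟙 S) s₀ ≪≫
          eqToIso (congrArg (fiberOver f) (AlgPoints.map_id_apply s₀))).hom.left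
        (fiberOverFamilyPullbackIso f (𝟙 S) s₀ ≪≫
          eqToIso (congrArg (fiberOver f) (AlgPoints.map_id_apply s₀))).inv.left
        (by rw [← Over.comp_left, Iso.hom_inv_id, Over.id_left])
        (by rw [← Over.comp_left, Iso.inv_hom_id, Over.id_left]) ≪≫
      (asIso i₀).symm, ?_⟩
  · show Etale (𝟙 S.left); infer_instance
  · show Flat (𝟙 _ ≫ pullback.snd f.left (𝟙 S.left)); infer_instance
  · -- read `key` on underlying schemes and compare the two composites out of the pull-back
    have h := congrArg CommaMorphism.left key
    simp only [Over.comp_left, Iso.trans_hom, Category.assoc] at h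
    rw [← Category.assoc, pullback.condition, Category.assoc]
    simp only [Iso.trans_hom, asIso_hom, Iso.symm_hom, asIso_inv, Category.assoc, Over.comp_left,
      IsIso.inv_hom_id_assoc, h]

/-! ### The fact in its corners, and the reduction to the interior range -/

/-- **Bloch's fact above the dimension (`n < p`) holds**, vacuously in `Z₀`: the purity clause
forces `Z₀ = ∅` (`isEmpty_of_forall_exists_coheight_eq_of_lt`) and the empty subscheme lifts
(`exists_etale_flat_lift_of_isEmpty`). Binder shape: that of `Bloch1972_semiregularSubschemeLifts`
with `n < p` inserted after `(n p : ℕ)`. [folklore] -/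
theorem Bloch1972_semiregularSubschemeLifts_of_lt :
    ∀ ⦃𝒳 S : SchemeOver ℂ⦄ (f : 𝒳 ⟶ S) (n p : ℕ), n < p → IsSmoothProjectiveFamily f n →
    (∃ (N : ℕ) (ε : 𝒳 ⟶ projectiveSpace N ℂ ⊗ S), IsClosedImmersion ε.left ∧
      ε ≫ CartesianMonoidalCategory.snd (projectiveSpace N ℂ) S = f) →
    _root_.AlgebraicGeometry.Smooth S.hom →
    ∀ (s₀ : ComplexPoints S) (Z₀ : Scheme) (i₀ : Z₀ ⟶ (fiberOver f s₀).left),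
      IsClosedImmersion i₀ →
      IsFiniteLocallyFree (conormalSheaf i₀) →
      (∀ z : Z₀, ∃ z' : Z₀, Order.coheight (i₀.base z') = (p : ℕ∞) ∧ i₀.base z' ⤳ i₀.base z) →
      (∀ z : Z₀, Order.coheight (i₀.base z) = (p : ℕ∞) →
        SupportClassStaysHodge f n p s₀ (closure {i₀.base z})) →
      IsBlochSemiregular i₀ n p →
      ∃ (V : SchemeOver ℂ) (π : V ⟶ S) (_ : Etale π.left) (v₀ : ComplexPoints V)
        (_ : AlgPoints.map π v₀ = s₀) (𝒵 : Scheme) (ι : 𝒵 ⟶ (familyPullback f π).left)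
        (_ : IsClosedImmersion ι) (_ : Flat (ι ≫ (familyPullback.snd f π).left))
        (e : pullback ι (fiberι (familyPullback.snd f π) v₀).left ≅ Z₀),
        pullback.fst ι (fiberι (familyPullback.snd f π) v₀).left ≫ ι ≫
            (familyPullback.fst f π).left =
          e.hom ≫ i₀ ≫ (fiberι f s₀).left := by
  intro 𝒳 S f n p hlt hf _ _ s₀ Z₀ i₀ _ _ hpure _ _
  haveI := isEmpty_of_forall_exists_coheight_eq_of_lt hf hlt i₀ hpure
  exact exists_etale_flat_lift_of_isEmpty f s₀ Z₀ i₀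

/-- **Bloch's fact in codimension `p = 0` holds**: either `Z₀ = ∅` (and the empty subscheme
lifts) or, by purity, `Z₀ = X₀` (`isIso_of_forall_exists_coheight_eq_zero`) and the whole fibre
lifts as `𝒳 ×_S S` (`exists_etale_flat_lift_of_isIso`, `f` being smooth, hence flat). Binder
shape: that of `Bloch1972_semiregularSubschemeLifts` at `p = 0`. [folklore] -/
theorem Bloch1972_semiregularSubschemeLifts_zero :
    ∀ ⦃𝒳 S : SchemeOver ℂ⦄ (f : 𝒳 ⟶ S) (n : ℕ), IsSmoothProjectiveFamily f n →
    (∃ (N : ℕ) (ε : 𝒳 ⟶ projectiveSpace N ℂ ⊗ S), IsClosedImmersion ε.left ∧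
      ε ≫ CartesianMonoidalCategory.snd (projectiveSpace N ℂ) S = f) →
    _root_.AlgebraicGeometry.Smooth S.hom →
    ∀ (s₀ : ComplexPoints S) (Z₀ : Scheme) (i₀ : Z₀ ⟶ (fiberOver f s₀).left),
      IsClosedImmersion i₀ →
      IsFiniteLocallyFree (conormalSheaf i₀) →
      (∀ z : Z₀, ∃ z' : Z₀, Order.coheight (i₀.base z') = ((0 : ℕ) : ℕ∞) ∧
        i₀.base z' ⤳ i₀.base z) →
      (∀ z : Z₀, Order.coheight (i₀.base z) = ((0 : ℕ) : ℕ∞) →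
        SupportClassStaysHodge f n 0 s₀ (closure {i₀.base z})) →
      IsBlochSemiregular i₀ n 0 →
      ∃ (V : SchemeOver ℂ) (π : V ⟶ S) (_ : Etale π.left) (v₀ : ComplexPoints V)
        (_ : AlgPoints.map π v₀ = s₀) (𝒵 : Scheme) (ι : 𝒵 ⟶ (familyPullback f π).left)
        (_ : IsClosedImmersion ι) (_ : Flat (ι ≫ (familyPullback.snd f π).left))
        (e : pullback ι (fiberι (familyPullback.snd f π) v₀).left ≅ Z₀),
        pullback.fst ι (fiberι (familyPullback.snd f π) v₀).left ≫ ι ≫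
            (familyPullback.fst f π).left =
          e.hom ≫ i₀ ≫ (fiberι f s₀).left := by
  intro 𝒳 S f n hf _ _ s₀ Z₀ i₀ hi₀ _ hpure _ _
  rcases isEmpty_or_nonempty Z₀ with hZ | hZ
  · exact exists_etale_flat_lift_of_isEmpty f s₀ Z₀ i₀
  · haveI := hi₀
    haveI := isIso_of_forall_exists_coheight_eq_zero hf i₀ hpure
    haveI : Flat f.left := by haveI := hf.smooth; infer_instance
    exact exists_etale_flat_lift_of_isIso f s₀ Z₀ i₀

/-- **Reduction of Bloch's fact to the interior range.** `Bloch1972_semiregularSubschemeLifts`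
follows from its restriction to `0 < p ≤ n` and `Z₀` non-empty (the hypothesis `h`: the fact's
statement with `0 < p → p ≤ n →` inserted after `(n p : ℕ)` and `Nonempty Z₀ →` after the binder
of `i₀`): the complement is covered by `exists_etale_flat_lift_of_isEmpty` (`Z₀ = ∅`),
`Bloch1972_semiregularSubschemeLifts_zero` (`p = 0`) and
`isEmpty_of_forall_exists_coheight_eq_of_lt` (`p > n`). A future discharge
`Bloch1972_semiregularSubschemeLifts_holds` may therefore assume `1 ≤ p ≤ n = dim X₀` and
`Z₀ ≠ ∅`, where all the tree's `ℕ`-indexed carriers (`IsBlochSemiregular`, `blochPairingMap`) have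
their printed meaning. [folklore] -/
theorem Bloch1972_semiregularSubschemeLifts.of_interior
    (h : ∀ ⦃𝒳 S : SchemeOver ℂ⦄ (f : 𝒳 ⟶ S) (n p : ℕ), 0 < p → p ≤ n →
      IsSmoothProjectiveFamily f n →
      (∃ (N : ℕ) (ε : 𝒳 ⟶ projectiveSpace N ℂ ⊗ S), IsClosedImmersion ε.left ∧
        ε ≫ CartesianMonoidalCategory.snd (projectiveSpace N ℂ) S = f) →
      _root_.AlgebraicGeometry.Smooth S.hom →
      ∀ (s₀ : ComplexPoints S) (Z₀ : Scheme) (i₀ : Z₀ ⟶ (fiberOver f s₀).left), Nonempty Z₀ →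
        IsClosedImmersion i₀ →
        IsFiniteLocallyFree (conormalSheaf i₀) →
        (∀ z : Z₀, ∃ z' : Z₀, Order.coheight (i₀.base z') = (p : ℕ∞) ∧ i₀.base z' ⤳ i₀.base z) →
        (∀ z : Z₀, Order.coheight (i₀.base z) = (p : ℕ∞) →
          SupportClassStaysHodge f n p s₀ (closure {i₀.base z})) →
        IsBlochSemiregular i₀ n p →
        ∃ (V : SchemeOver ℂ) (π : V ⟶ S) (_ : Etale π.left) (v₀ : ComplexPoints V)
          (_ : AlgPoints.map π v₀ = s₀) (𝒵 : Scheme) (ι : 𝒵 ⟶ (familyPullback f π).left)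
          (_ : IsClosedImmersion ι) (_ : Flat (ι ≫ (familyPullback.snd f π).left))
          (e : pullback ι (fiberι (familyPullback.snd f π) v₀).left ≅ Z₀),
          pullback.fst ι (fiberι (familyPullback.snd f π) v₀).left ≫ ι ≫
              (familyPullback.fst f π).left =
            e.hom ≫ i₀ ≫ (fiberι f s₀).left) :
    Bloch1972_semiregularSubschemeLifts := by
  intro 𝒳 S f n p hf hproj hS s₀ Z₀ i₀ hi₀ hlci hpure hclass hsr
  rcases isEmpty_or_nonempty Z₀ with hZ | hZ
  · exact exists_etale_flat_lift_of_isEmpty f s₀ Z₀ i₀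
  rcases Nat.eq_zero_or_pos p with rfl | hp
  · exact Bloch1972_semiregularSubschemeLifts_zero f n hf hproj hS s₀ Z₀ i₀ hi₀ hlci hpure hclass
      hsr
  rcases le_or_gt p n with hpn | hnp
  · exact h f n p hp hpn hf hproj hS s₀ Z₀ i₀ hZ hi₀ hlci hpure hclass hsr
  · exact ((isEmpty_of_forall_exists_coheight_eq_of_lt hf hnp i₀ hpure).false hZ.some).elim

end HodgeTheory

end Literature.AlgebraicGeometry.HodgeTheory

end
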